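import Summits.ResolutionOfSingularities.ResolutionOfSingularities.Theorems.WeightedInvariantP3aSpecialFibre
import HarnessLib

/-!
# The P3a cylinder move, type (b) successors: the transform `G`, its face form `Φ ≠ 0`, order transfer (ORDER (o36))

Topic: `Summits/ResolutionOfSingularities/ResolutionOfSingularities/Theorems`. Helper for the door item
`HypersurfaceCentreConstruction` (statement `stmt-ResolutionOfSingularities-19897`, route `WeightedInvariant`), line
`local-engine` of `res-L1-w43-plan-1`, IOTA3-DESIGN v1.3 §8.4 regime CURVE° «ν drops strictly at every successor»
(RULING gen 11 #2, 2026-08-27T12:09:48Z), ORDER (o36) held by res-type-092 (design memo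
`plan/tools/res-type-092/o36/O36-DESIGN.md` c9cc04d440dbcb6e §2/§6, type (b) = successors OVER THE SPECIAL POINT).

SETTING. `S` regular local with regular system of parameters `(y, x, z)` (`span = 𝔪`, `spanFinrank 𝔪 = 3`),
`P = (y, x)` prime, weights `(r, q)` on `(y, x)` (positive), `B = S[t⁻¹, 𝒥ₙ tⁿ]`, `𝒥ₙ = 𝒥ₙ((y, x); (r, q))` — the
cobordant algebra of the CYLINDER `V(P)` with the transversal weights (the variable `z` has weight `0` and lives in the
coefficient ring `A = S ⧸ P`, a discrete valuation ring).  CONTENTS (def-free; every map is delivered by `∃`; §1–§2 are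
the sibling `…P3aSpecialFibre`, THIS FILE is §3–§5, split for the 400-line rule):

* §1 `linearIndependent_toCotangent_pair` — `(y, x)` is a cotangent-independent sub-family (input of res-type-092's
  `LocalGameEFTPointMove.exists_rhoPartial`, p531646: the chart `ρ : B ↠ A[X₀, X₁]`, `ker ρ = (t⁻¹)`).
* §2 **`exists_rhoZero`** — the SPECIAL-FIBRE CHART `ρ₀ : B ↠ κ[X₀, X₁]` (`κ = S ⧸ 𝔪`), `ρ₀ = (A → κ) ∘ ρ`:
  `ρ₀(y t^r) = X₀`, `ρ₀(x t^q) = X₁`, `ρ₀(a) = ā`, **`ker ρ₀ = (t⁻¹, z)`** (`𝔪 = P + (z)`); a prime `𝔫 ∋ t⁻¹, z` of `B`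
  (a successor over the special point) is `ρ₀⁻¹(𝔫̄₀)`, `𝔫̄₀ = ρ₀(𝔫)` prime, off the vertex `⇒ (X₀, X₁) ⊄ 𝔫̄₀`.
* §3 `exists_finsupp_of_mem_weightedMonomialIdeal` (a member of `𝒥ₙ(u; w)` is a finite `S`-combination of monomials
  of weight `≥ n`) and **`exists_transform_of_finsupp`**: `f = (t⁻¹)ⁿ · G` with
  `ρ₀(G) = Φ := Σ_{w·α = n} ā_α X^α` — the `(r, q)`-FACE FORM OF THE SPECIAL FIBRE `f₀ = f(y, x, 0)`.
* §4 `face_ne_zero`: for `n = rν`, `q ≤ r` and `f ∉ 𝔪^{ν+1}`, `Φ ≠ 0` (faces of `𝒥_{rν}` have total degree `≥ ν`,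
  `𝒥_{rν+1} ⊆ 𝔪^{ν+1}`); hence `t⁻¹ ∤ G` and (`B` a domain, `(t⁻¹)` prime) EVERY saturated factorisation
  `f = (t⁻¹)ᵃ g`, `t⁻¹ ∤ g`, has `g = G` (`transform_unique₀`).
* §5 TRANSFER `not_mem_pow_of_rhoZero`: `Φ/1 ∉ 𝔪_{𝔫̄₀}^ν ⇒ g/1 ∉ 𝔪_𝔫^ν`; `Φ ∉ 𝔫̄₀ ⇒ g/1` a unit.

The sequel `…P3aTieFreeDrop` feeds `Φ` to res-type-098's face bound `LexMaxOrderDrop.algebraMap_lexFace_notMem_pow`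
(non-degenerate faces) and treats the tie curve.  [OURS · L1 W4.3] Replaces the role of NO printed item; NOT a statement
of the manuscript under review [claim: Hironaka2017, status: under-review].  AI work, weaker than expert review.

## References

* J. Włodarczyk, *Functorial resolution by torus actions*, arXiv:2203.03090, §2.3.9, §3.3, Lemma 4.1.7. [Wlodarczyk2022]
* D. Abramovich, M. H. Quek, B. Schober, arXiv:2507.01232 (v3, 2026), Thm 1.3 (3), §5. [AbramovichQuekSchober2025]
-/

noncomputable section

open IsLocalRing Literature.AlgebraicGeometry.Resolution
open LaurentPolynomial
open scoped LaurentPolynomial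

set_option linter.dupNamespace false -- mandated namespace of this single-conjunct summit

namespace Summit.ResolutionOfSingularities.ResolutionOfSingularities.Theorems

namespace LocalGameEFTCylinder

universe u

variable {S : Type} [CommRing S]

/-! ### §3 Finite monomial representations and the transform `G` -/

section Transform

variable {d : ℕ} (u : Fin d → S) (w : Fin d → ℕ)

/-- The generating monomials of `𝒥ₙ(u; w)` as an image set. [folklore] -/
theorem setOf_monomial_eq_image (n : ℕ) :
    {m : S | ∃ α : Fin d → ℕ, n ≤ ∑ i, w i * α i ∧ m = ∏ i, u i ^ α i} =
      (fun α : Fin d → ℕ => ∏ i, u i ^ α i) '' {α | n ≤ ∑ i, w i * α i} := by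
  ext m
  constructor
  · rintro ⟨α, hα, rfl⟩; exact ⟨α, hα, rfl⟩
  · rintro ⟨α, hα, rfl⟩; exact ⟨α, hα, rfl⟩

/-- **A member of `𝒥ₙ(u; w)` is a finite `S`-linear combination of monomials of weight `≥ n`.** [folklore] -/
theorem exists_finsupp_of_mem_weightedMonomialIdeal {n : ℕ} {f : S} (hf : f ∈ weightedMonomialIdeal u w n) :
    ∃ l : (Fin d → ℕ) →₀ S, (∀ α ∈ l.support, n ≤ ∑ i, w i * α i) ∧
      f = ∑ α ∈ l.support, l α * ∏ i, u i ^ α i := by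
  rw [weightedMonomialIdeal, setOf_monomial_eq_image, Ideal.span,
    Finsupp.mem_span_image_iff_linearCombination] at hf
  obtain ⟨l, hl, hlf⟩ := hf
  refine ⟨l, fun α hα => hl hα, ?_⟩
  rw [← hlf, Finsupp.linearCombination_apply, Finsupp.sum]
  simp only [smul_eq_mul]

variable {κ : Type} [CommRing κ] (res : S →+* κ)
  (ρ₀ : extReesAlgebra (weightedMonomialIdeal u w) →+* MvPolynomial (Fin d) κ)
  (hX : ∀ i, ρ₀ (LocalGameEFTPointMove.uT u w i) = MvPolynomial.X i)
  (hC : ∀ a : S, ρ₀ (algebraMap S _ a) = MvPolynomial.C (res a))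
  (hT : ρ₀ (extReesAlgebra.tInv (weightedMonomialIdeal u w)) = 0)

include hX hC hT in
/-- **The transform and its special-fibre face form.**  If `f = Σ_{α ∈ supp l} l_α u^α` with `w·α ≥ n` on the
support, then `f = (t⁻¹)ⁿ · G` in `B` for `G = Σ l_α (t⁻¹)^{w·α-n} u'^α`, and
`ρ₀(G) = Φ = Σ_{w·α = n} res(l_α) X^α` (monomial form). [cite: Wlodarczyk2022, §3.3, Lemma 4.1.7] -/
theorem exists_transform_of_finsupp (l : (Fin d → ℕ) →₀ S) {n : ℕ} (hl : ∀ α ∈ l.support, n ≤ ∑ i, w i * α i)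
    {f : S} (hf : f = ∑ α ∈ l.support, l α * ∏ i, u i ^ α i) :
    ∃ G : extReesAlgebra (weightedMonomialIdeal u w),
      algebraMap S _ f = extReesAlgebra.tInv (weightedMonomialIdeal u w) ^ n * G ∧
      ρ₀ G = ∑ α ∈ l.support.filter (fun α => ∑ i, w i * α i = n),
        MvPolynomial.monomial (Finsupp.equivFunOnFinite.symm α) (res (l α)) := by
  classical
  refine ⟨∑ α ∈ l.support, algebraMap S _ (l α) *
      extReesAlgebra.tInv (weightedMonomialIdeal u w) ^ (∑ i, w i * α i - n) *
        ∏ i, LocalGameEFTPointMove.uT u w i ^ α i, ?_, ?_⟩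
  · rw [hf, map_sum, Finset.mul_sum]
    refine Finset.sum_congr rfl fun α hα => ?_
    rw [map_mul, map_prod]
    simp_rw [map_pow, LocalGameEFTPointMove.algebraMap_u_eq u w, mul_pow, Finset.prod_mul_distrib, ← pow_mul,
      Finset.prod_pow_eq_pow_sum]
    rw [show (∑ i, w i * α i) = n + (∑ i, w i * α i - n) from (Nat.add_sub_cancel' (hl α hα)).symm, pow_add,
      Nat.add_sub_cancel_left]
    ring
  · rw [map_sum, Finset.sum_filter]
    refine Finset.sum_congr rfl fun α hα => ?_
    rw [map_mul, map_mul, map_pow, map_prod, hT, hC]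
    simp_rw [map_pow, hX]
    split_ifs with h
    · rw [h, Nat.sub_self, pow_zero, mul_one, MvPolynomial.monomial_eq]
      congr 1
      rw [Finsupp.prod_fintype _ _ (fun i => pow_zero _)]
      simp
    · have hlt : n < ∑ i, w i * α i := lt_of_le_of_ne (hl α hα) (Ne.symm h)
      rw [zero_pow (by omega), mul_zero, zero_mul]

/-- The coefficient of `X^β` in a face form in monomial form. [folklore] -/
theorem coeff_face (s : Finset (Fin d → ℕ)) (c : (Fin d → ℕ) → κ) (β : Fin d → ℕ) :
    MvPolynomial.coeff (Finsupp.equivFunOnFinite.symm β)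
        (∑ α ∈ s, MvPolynomial.monomial (Finsupp.equivFunOnFinite.symm α) (c α)) =
      if β ∈ s then c β else 0 := by
  classical
  rw [MvPolynomial.coeff_sum]
  simp_rw [MvPolynomial.coeff_monomial]
  split_ifs with hβ
  · rw [Finset.sum_eq_single β (fun α _ hne => if_neg fun h =>
        hne ((Finsupp.equivFunOnFinite (α := Fin d) (M := ℕ)).symm.injective h)) (fun h => absurd hβ h), if_pos rfl]
  · exact Finset.sum_eq_zero fun α hα => if_neg fun h => by
      have hαβ : α = β := (Finsupp.equivFunOnFinite (α := Fin d) (M := ℕ)).symm.injective h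
      exact hβ (hαβ ▸ hα)

end Transform

/-! ### §4 The face form is non-zero; uniqueness of the saturated factorisation -/

section Face

variable [IsLocalRing S] {y x z : S} (hyxz : Ideal.span (Set.range ![y, x, z]) = maximalIdeal S)
  {r q : ℕ} (hr : 0 < r) (hqr : q ≤ r)

/-- A monomial `y^{α₀} x^{α₁}` lies in `𝔪^{α₀ + α₁}`. [folklore] -/
theorem prod_pow_mem_pow_pair (hyxz : Ideal.span (Set.range ![y, x, z]) = maximalIdeal S) (α : Fin 2 → ℕ) :
    ∏ i, ![y, x] i ^ α i ∈ maximalIdeal S ^ ∑ i, α i := by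
  have h : ∏ i, ![y, x] i ^ α i ∈ ∏ i, maximalIdeal S ^ α i :=
    Ideal.prod_mem_prod fun i _ => Ideal.pow_mem_pow (mem_maximalIdeal_pair hyxz i) _
  rwa [Finset.prod_pow_eq_pow_sum] at h

include hr hqr in
/-- Degrees on and above the face: `r α₀ + q α₁ ≥ rν (+1)` with `q ≤ r` forces `α₀ + α₁ ≥ ν (+1)`. [folklore] -/
theorem le_degree_of_le_weight {ν : ℕ} {α : Fin 2 → ℕ} {e : ℕ} (he : e ≤ 1)
    (hα : r * ν + e ≤ ∑ i, ![r, q] i * α i) : ν + e ≤ ∑ i, α i := by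
  rw [Fin.sum_univ_two] at hα ⊢
  simp only [Matrix.cons_val_zero, Matrix.cons_val_one] at hα ⊢
  have h1 : r * ν + e ≤ r * (α 0 + α 1) := by nlinarith
  rcases Nat.eq_zero_or_pos e with rfl | he1
  · exact Nat.le_of_mul_le_mul_left (by simpa using h1) hr
  · have : r * ν < r * (α 0 + α 1) := by omega
    have := Nat.lt_of_mul_lt_mul_left this
    omega

include hyxz hr hqr in
/-- **The special-fibre face form is non-zero.**  If `f = Σ_{α ∈ supp l} l_α y^{α₀}x^{α₁}` with `rα₀ + qα₁ ≥ rν` on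
the support, `q ≤ r`, and `f ∉ 𝔪^{ν+1}`, then some face coefficient (`rα₀ + qα₁ = rν`) is a unit: the face form
`Φ = Σ_{face} l̄_α X^α ∈ κ[X₀, X₁]` is `≠ 0`. [cite: AbramovichQuekSchober2025, §5] -/
theorem face_ne_zero {κ : Type} [CommRing κ] {res : S →+* κ} (hres : ∀ a, res a = 0 → a ∈ maximalIdeal S)
    (l : (Fin 2 → ℕ) →₀ S) {ν : ℕ} (hl : ∀ α ∈ l.support, r * ν ≤ ∑ i, ![r, q] i * α i) {f : S}
    (hf : f = ∑ α ∈ l.support, l α * ∏ i, ![y, x] i ^ α i) (hfν : f ∉ maximalIdeal S ^ (ν + 1)) :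
    ∑ α ∈ l.support.filter (fun α => ∑ i, ![r, q] i * α i = r * ν),
      MvPolynomial.monomial (Finsupp.equivFunOnFinite.symm α) (res (l α)) ≠ 0 := by
  classical
  intro hΦ
  apply hfν
  rw [hf]
  refine Ideal.sum_mem _ fun α hα => ?_
  by_cases hface : ∑ i, ![r, q] i * α i = r * ν
  · -- a face coefficient lies in `𝔪`
    have hcoeff := congrArg (MvPolynomial.coeff (Finsupp.equivFunOnFinite.symm α)) hΦ
    rw [coeff_face, if_pos (Finset.mem_filter.mpr ⟨hα, hface⟩), MvPolynomial.coeff_zero] at hcoeff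
    have hlα : l α ∈ maximalIdeal S := hres _ hcoeff
    have hdeg : ν ≤ ∑ i, α i := by
      have h := le_degree_of_le_weight hr hqr (ν := ν) (α := α) (e := 0) zero_le_one (by rw [add_zero, hface])
      simpa using h
    rw [pow_succ']
    exact Ideal.mul_mem_mul hlα (Ideal.pow_le_pow_right hdeg (prod_pow_mem_pow_pair hyxz α))
  · have hlt : r * ν + 1 ≤ ∑ i, ![r, q] i * α i := by have := hl α hα; omega
    have hdeg : ν + 1 ≤ ∑ i, α i := le_degree_of_le_weight hr hqr le_rfl hlt
    exact Ideal.mul_mem_left _ _ (Ideal.pow_le_pow_right hdeg (prod_pow_mem_pow_pair hyxz α))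

end Face

section Unique

variable {d : ℕ} (u : Fin d → S) (w : Fin d → ℕ)

/-- `t⁻¹ ∤ G` when `G` has non-zero image under a map killing `t⁻¹`. [folklore] -/
theorem not_dvd_of_map_ne_zero {P : Type} [CommRing P] (ρ₀ : extReesAlgebra (weightedMonomialIdeal u w) →+* P)
    (hT : ρ₀ (extReesAlgebra.tInv (weightedMonomialIdeal u w)) = 0) {G : extReesAlgebra (weightedMonomialIdeal u w)}
    (hG : ρ₀ G ≠ 0) : ¬ extReesAlgebra.tInv (weightedMonomialIdeal u w) ∣ G := by
  rintro ⟨c, rfl⟩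
  exact hG (by rw [map_mul, hT, zero_mul])

/-- **Uniqueness of the saturated factorisation** (`S` a domain): `f = (t⁻¹)ⁿ G = (t⁻¹)ᵃ g` with `t⁻¹ ∤ G`,
`t⁻¹ ∤ g` forces `a = n` and `g = G`. [cite: Wlodarczyk2022, §3.3] -/
theorem transform_unique₀ [IsDomain S] {f : S} {n a : ℕ} {G g : extReesAlgebra (weightedMonomialIdeal u w)}
    (hG : algebraMap S _ f = extReesAlgebra.tInv (weightedMonomialIdeal u w) ^ n * G)
    (hndG : ¬ extReesAlgebra.tInv (weightedMonomialIdeal u w) ∣ G)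
    (hg : algebraMap S _ f = extReesAlgebra.tInv (weightedMonomialIdeal u w) ^ a * g)
    (hndg : ¬ extReesAlgebra.tInv (weightedMonomialIdeal u w) ∣ g) : a = n ∧ g = G :=
  LocalGameEFTPointMove.pow_mul_cancel_of_not_dvd
    (nonZeroDivisors.ne_zero (tInv_mem_nonZeroDivisors (weightedMonomialIdeal u w))) (hg.symm.trans hG) hndg hndG

end Unique

/-! ### §5 Transfer of the order bound through `ρ₀` -/

section Transfer

variable {B P : Type} [CommRing B] [CommRing P] (ρ₀ : B →+* P)

/-- **Orders do not decrease under the local surjection `B_𝔫 → P_{𝔫̄₀}`**: if `ρ₀(G)/1 ∉ 𝔪_{𝔫̄₀}^ν` then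
`G/1 ∉ 𝔪_𝔫^ν`. [folklore] -/
theorem not_mem_pow_of_map (𝔫 : Ideal B) [𝔫.IsPrime] (𝔫' : Ideal P) [𝔫'.IsPrime] (h : 𝔫 = 𝔫'.comap ρ₀) {G : B}
    {ν : ℕ} (hG : algebraMap P (Localization.AtPrime 𝔫') (ρ₀ G) ∉ maximalIdeal (Localization.AtPrime 𝔫') ^ ν) :
    algebraMap B (Localization.AtPrime 𝔫) G ∉ maximalIdeal (Localization.AtPrime 𝔫) ^ ν := by
  intro hmem
  apply hG
  set φ : Localization.AtPrime 𝔫 →+* Localization.AtPrime 𝔫' := Localization.localRingHom 𝔫 𝔫' ρ₀ h with hφ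
  have hloc : IsLocalHom φ := Localization.isLocalHom_localRingHom 𝔫 𝔫' ρ₀ h
  have hle : (maximalIdeal (Localization.AtPrime 𝔫)).map φ ≤ maximalIdeal (Localization.AtPrime 𝔫') :=
    @IsLocalRing.map_maximalIdeal_le _ _ _ _ _ _ φ hloc
  have h1 : φ (algebraMap B (Localization.AtPrime 𝔫) G) ∈ (maximalIdeal (Localization.AtPrime 𝔫) ^ ν).map φ :=
    Ideal.mem_map_of_mem φ hmem
  rw [Ideal.map_pow, hφ, Localization.localRingHom_to_map] at h1
  exact Ideal.pow_right_mono hle ν h1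

/-- **Off the face locus the transform is a unit**: if `ρ₀(G) ∉ 𝔫̄₀` then `G/1 ∉ 𝔪_𝔫^ν` for every `ν ≥ 1`.
[folklore] -/
theorem not_mem_pow_of_map_notMem (𝔫 : Ideal B) [𝔫.IsPrime] (𝔫' : Ideal P) (h : 𝔫 = 𝔫'.comap ρ₀) {G : B}
    (hG : ρ₀ G ∉ 𝔫') {ν : ℕ} (hν : 1 ≤ ν) :
    algebraMap B (Localization.AtPrime 𝔫) G ∉ maximalIdeal (Localization.AtPrime 𝔫) ^ ν := by
  intro hmem
  have hG𝔫 : G ∉ 𝔫 := fun hG𝔫 => hG (by rw [h, Ideal.mem_comap] at hG𝔫; exact hG𝔫)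
  have hunit : IsUnit (algebraMap B (Localization.AtPrime 𝔫) G) :=
    IsLocalization.map_units (M := 𝔫.primeCompl) _ ⟨G, hG𝔫⟩
  exact (mem_maximalIdeal _).mp (Ideal.pow_le_self (by omega) hmem) hunit

/-- `adicOrder` form of the conclusion: `G/1 ∉ 𝔪^ν ⇒ adicOrder (G/1) < ν` (`ν ≥ 1`). [folklore] -/
theorem adicOrder_lt_of_not_mem_pow {L : Type} [CommRing L] [IsLocalRing L] {g : L} {ν : ℕ} (hν : 1 ≤ ν)
    (h : g ∉ maximalIdeal L ^ ν) : adicOrder g < (ν : ℕ∞) := by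
  obtain ⟨k, rfl⟩ : ∃ k, ν = k + 1 := ⟨ν - 1, by omega⟩
  exact (adicOrder_lt_iff g k).mpr h

end Transfer

end LocalGameEFTCylinder

end Summit.ResolutionOfSingularities.ResolutionOfSingularities.Theorems

end
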